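import Summits.HubbardSuperconductivity.HubbardSuperconductivity.Theses.BcsKacWindow
import Summits.HubbardSuperconductivity.HubbardSuperconductivity.Theorems.BcsKacWindowShellMultiplicityBound

/-!
# F3 WITNESS — `PairShellUpTo 0` IS the floor `ShellMultiplicityBound` (seed theorem
# `Theorems.BcsKacWindow.shellMultiplicityBound_proof`, item `stmt-HubbardSuperconductivity-1325`)

Published as `Cruxes/NoCondensateBelowAndersonLength/Lines/pair_shell_rung_special.lean` next to the line
skeleton `Cruxes/NoCondensateBelowAndersonLength/Lines/pair_shell_rung.lean` (forward generator G1,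
seat `fwd-rung-HubbardSuperconductivity-02`, seed `g1-HubbardSuperconductivity-1325`). Self-contained so
that it re-elaborates standalone: the definitions below are §1 of the line file VERBATIM (same namespace,
same bodies) — do not import this file together with the line file (duplicate declarations).

FLOOR (proved): the one-particle Fermi shells `#{(a,b) ∈ (ℤ/L)² : cos(2πa/L) + cos(2πb/L) = E}` are
bounded uniformly in `L` and `E ≠ 0`.
ONE MOVE (parameter: total pair momentum `Q = (2πq₁/L, 2πq₂/L)` extended from `Q = 0` to all `Q`): the
two-particle (pair) shells `#{k : ε(k) + ε(Q-k) = W}` bounded uniformly in `L, Q, W` away from the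
degenerate loci. GRADED FAMILY `PairShellUpTo K` (pair-momentum indices `≤ K`); `K = 0` is the floor:
`pairShellUpTo_zero : PairShellUpTo 0` (the F3 `example`, an 8-line proof from the seed theorem:
`cos(2π(0-a)/L) = cos(2πa/L)` and `2x = 2E ↔ x = E`), and conversely
`pairShellUpTo_zero_iff : PairShellUpTo 0 ↔ ShellMultiplicityBound` (the family is anchored exactly at
the seed). The RUNG `PairShellMultiplicityBound` (uniform in `Q`) gives every `PairShellUpTo K`
(`pairShellUpTo_of_bound`). No `sorry` in this file.
-/

set_option linter.dupNamespace false

namespace Summit.HubbardSuperconductivity.HubbardSuperconductivity.Cruxes.NoCondensateBelowAndersonLength.PairShellRung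

open Finset
open Summit.HubbardSuperconductivity.HubbardSuperconductivity.Theses.BcsKacWindow
  (ShellMultiplicityBound)
open Summit.HubbardSuperconductivity.HubbardSuperconductivity.Theorems.BcsKacWindow
  (shellMultiplicityBound_proof)

/-- GRADED FAMILY. Pair shells with pair-momentum indices `q₁, q₂ ≤ K` are uniformly bounded:
`∃ M₀ ∀ L ∀ q₁ q₂ ≤ K ∀ E ≠ 0` (non-degenerate `Q`),
`#{(a,b) ∈ (ℤ/L)² : cos(2πa/L) + cos(2π(q₁-a)/L) + cos(2πb/L) + cos(2π(q₂-b)/L) = 2E} ≤ M₀`.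
`K = 0` is the floor `ShellMultiplicityBound`. -/
def PairShellUpTo (K : ℕ) : Prop :=
  ∃ M₀ : ℕ, ∀ (L q₁ q₂ : ℕ) (E : ℝ), q₁ ≤ K → q₂ ≤ K → E ≠ 0 →
    Real.cos (Real.pi * q₁ / L) ≠ 0 → Real.cos (Real.pi * q₂ / L) ≠ 0 →
    (Finset.univ.filter (fun p : Fin L × Fin L =>
      Real.cos (2 * Real.pi * (p.1 : ℕ) / L) + Real.cos (2 * Real.pi * ((q₁ : ℝ) - (p.1 : ℕ)) / L)
        + (Real.cos (2 * Real.pi * (p.2 : ℕ) / L)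
          + Real.cos (2 * Real.pi * ((q₂ : ℝ) - (p.2 : ℕ)) / L)) = 2 * E)).card ≤ M₀

/-- THE RUNG (`rung_decl`). Uniform multiplicity of the two-particle (pair) shells of the
square-lattice torus at EVERY total pair momentum `Q = (2πq₁/L, 2πq₂/L)`:
`∃ M₀ ∀ L q₁ q₂ ∀ E ≠ 0`, if `cos(πq₁/L) ≠ 0` and `cos(πq₂/L) ≠ 0` then
`#{(a,b) ∈ (ℤ/L)² : cos(2πa/L) + cos(2π(q₁-a)/L) + cos(2πb/L) + cos(2π(q₂-b)/L) = 2E} ≤ M₀`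
(equivalently `#{k : ε(k) + ε(Q-k) = -4E} ≤ M₀` for `ε(k) = -2(cos k₁ + cos k₂)`). -/
def PairShellMultiplicityBound : Prop :=
  ∃ M₀ : ℕ, ∀ (L q₁ q₂ : ℕ) (E : ℝ), E ≠ 0 →
    Real.cos (Real.pi * q₁ / L) ≠ 0 → Real.cos (Real.pi * q₂ / L) ≠ 0 →
    (Finset.univ.filter (fun p : Fin L × Fin L =>
      Real.cos (2 * Real.pi * (p.1 : ℕ) / L) + Real.cos (2 * Real.pi * ((q₁ : ℝ) - (p.1 : ℕ)) / L)
        + (Real.cos (2 * Real.pi * (p.2 : ℕ) / L)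
          + Real.cos (2 * Real.pi * ((q₂ : ℝ) - (p.2 : ℕ)) / L)) = 2 * E)).card ≤ M₀

/-- The rung dominates every member of the graded family (one constant for all `K`). -/
theorem pairShellUpTo_of_bound (h : PairShellMultiplicityBound) (K : ℕ) : PairShellUpTo K := by
  obtain ⟨M₀, hM⟩ := h
  exact ⟨M₀, fun L q₁ q₂ E _ _ hE hq₁ hq₂ => hM L q₁ q₂ E hE hq₁ hq₂⟩

/-- The family is monotone in `K`. -/
theorem pairShellUpTo_mono {K K' : ℕ} (hKK' : K ≤ K') (h : PairShellUpTo K') : PairShellUpTo K := by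
  obtain ⟨M₀, hM⟩ := h
  exact ⟨M₀, fun L q₁ q₂ E hq₁ hq₂ => hM L q₁ q₂ E (hq₁.trans hKK') (hq₂.trans hKK')⟩

/-- At `Q = 0` the pair-shell equation is the floor's shell equation. -/
theorem filter_pairShell_zero_eq (L : ℕ) (E : ℝ) :
    (Finset.univ.filter (fun p : Fin L × Fin L =>
      Real.cos (2 * Real.pi * (p.1 : ℕ) / L) + Real.cos (2 * Real.pi * (((0 : ℕ) : ℝ) - (p.1 : ℕ)) / L)
        + (Real.cos (2 * Real.pi * (p.2 : ℕ) / L)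
          + Real.cos (2 * Real.pi * (((0 : ℕ) : ℝ) - (p.2 : ℕ)) / L)) = 2 * E)) =
    Finset.univ.filter (fun p : Fin L × Fin L =>
      Real.cos (2 * Real.pi * (p.1 : ℕ) / L) + Real.cos (2 * Real.pi * (p.2 : ℕ) / L) = E) := by
  apply Finset.filter_congr
  intro p _
  have h1 : Real.cos (2 * Real.pi * (((0 : ℕ) : ℝ) - (p.1 : ℕ)) / L) =
      Real.cos (2 * Real.pi * (p.1 : ℕ) / L) := by
    rw [← Real.cos_neg]
    congr 1
    push_cast
    ring
  have h2 : Real.cos (2 * Real.pi * (((0 : ℕ) : ℝ) - (p.2 : ℕ)) / L) =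
      Real.cos (2 * Real.pi * (p.2 : ℕ) / L) := by
    rw [← Real.cos_neg]
    congr 1
    push_cast
    ring
  rw [h1, h2]
  constructor
  · intro h
    linarith
  · intro h
    linarith

/-- WITNESS (F3 / BC5): the floor member `K = 0` of the family IS the proved floor
`ShellMultiplicityBound` — from the seed theorem `shellMultiplicityBound_proof`. -/
theorem pairShellUpTo_zero : PairShellUpTo 0 := by
  obtain ⟨M₀, hM⟩ := shellMultiplicityBound_proof
  refine ⟨M₀, fun L q₁ q₂ E hq₁ hq₂ hE _ _ => ?_⟩
  obtain rfl : q₁ = 0 := Nat.le_zero.mp hq₁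
  obtain rfl : q₂ = 0 := Nat.le_zero.mp hq₂
  rw [filter_pairShell_zero_eq L E]
  exact hM L E hE

/-- Conversely the floor member gives back the floor (so `PairShellUpTo 0 ↔ ShellMultiplicityBound`:
the family is anchored exactly at the seed). -/
theorem shellMultiplicityBound_of_pairShellUpTo_zero (h : PairShellUpTo 0) : ShellMultiplicityBound := by
  obtain ⟨M₀, hM⟩ := h
  refine ⟨M₀, fun L E hE => ?_⟩
  have h1 : Real.cos (Real.pi * ((0 : ℕ) : ℝ) / L) ≠ 0 := by simp
  have := hM L 0 0 E le_rfl le_rfl hE h1 h1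
  rwa [filter_pairShell_zero_eq L E] at this

theorem pairShellUpTo_zero_iff : PairShellUpTo 0 ↔ ShellMultiplicityBound :=
  ⟨shellMultiplicityBound_of_pairShellUpTo_zero, fun _ => pairShellUpTo_zero⟩

/-- **F3, literally**: the rung family at the floor's parameter, from the seed theorem. -/
example : PairShellUpTo 0 := pairShellUpTo_zero

/-- The floor recovered from the family (so `floor ↔ PairShellUpTo 0`). -/
example : ShellMultiplicityBound := shellMultiplicityBound_of_pairShellUpTo_zero pairShellUpTo_zero

end Summit.HubbardSuperconductivity.HubbardSuperconductivity.Cruxes.NoCondensateBelowAndersonLength.PairShellRung
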